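import Summits.Ventures.Crystal3D.StickySpheres.FccPieces
import HarnessLib

/-!
# The fcc staircase: an `L × m × m` box plus `s` rows, and its exact lattice-contact count

HONEST FRAMING. Part of the venture `Summits/Ventures/Crystal3D` (cell `pub-crystal3d`; seat p3 g11).
Construction side only [folklore]: the finite piece `stair m L s` of the face-centred cubic lattice — the box
`[0,L) × [0,m) × [0,m)` of coefficient vectors (primitive basis of `StickySpheres/FccChunks.lean`) topped by
the `s < m` full rows `{L} × [0,s) × [0,m)` of the next close-packed layer, `L·m² + s·m` balls — and the
EXACT lower bound `stairContacts m L s ≤ C(L·m² + s·m)` obtained by exhibiting, for each of the six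
nearest-neighbour directions `δ` (and hence for `−δ`), two disjoint integer boxes `T ⊆ S` with `T + δ ⊆ S`
(`StickySpheres/FccPieces.lean`; memberships are linear integer arithmetic, `omega`). The deficit identity
`6(L·m² + s·m) + L + 2m + [s≠0] = stairContacts + 6Lm + 3m² + [s≠0](3s + 2m)` (`stairContacts_identity`)
says the staircase misses exactly `L(6m−1) + 3m² − 2m + [s≠0](3s + 2m − 1)` contacts from six per ball.
Consequence in `StickySpheres/FccAllN.lean`: `6N − 10·N^{2/3} ≤ C(N)` for every `N`. Nothing is claimed
about ground-state geometry; no number of the cell moves.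
-/

noncomputable section

open scoped BigOperators
open Finset

namespace Summit.Ventures.Crystal3D

/-! ## Three-dimensional boxes with listed corners, and offsets with listed entries -/

/-- The box `[l₀,h₀) × [l₁,h₁) × [l₂,h₂)` of `ℤ³`. -/
def box3 (l₀ h₀ l₁ h₁ l₂ h₂ : ℤ) : Finset (Fin 3 → ℤ) := box ![l₀, l₁, l₂] ![h₀, h₁, h₂]

/-- Membership in `box3` as six inequalities. -/
theorem mem_box3 {l₀ h₀ l₁ h₁ l₂ h₂ : ℤ} {a : Fin 3 → ℤ} :
    a ∈ box3 l₀ h₀ l₁ h₁ l₂ h₂ ↔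
      l₀ ≤ a 0 ∧ a 0 < h₀ ∧ l₁ ≤ a 1 ∧ a 1 < h₁ ∧ l₂ ≤ a 2 ∧ a 2 < h₂ := by
  rw [box3, mem_box, Fin.forall_fin_succ, Fin.forall_fin_succ, Fin.forall_fin_succ]
  simp [and_assoc]

/-- Cardinality of `box3` with natural-number corners `lᵢ ≤ hᵢ`. -/
theorem card_box3 (l₀ h₀ l₁ h₁ l₂ h₂ : ℕ) (h0 : l₀ ≤ h₀) (h1 : l₁ ≤ h₁) (h2 : l₂ ≤ h₂) :
    (box3 l₀ h₀ l₁ h₁ l₂ h₂).card = (h₀ - l₀) * (h₁ - l₁) * (h₂ - l₂) := by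
  have e1 : (![(l₀ : ℤ), l₁, l₂] : Fin 3 → ℤ) = fun k => ((![l₀, l₁, l₂] : Fin 3 → ℕ) k : ℤ) := by
    funext k; fin_cases k <;> simp
  have e2 : (![(h₀ : ℤ), h₁, h₂] : Fin 3 → ℤ) = fun k => ((![h₀, h₁, h₂] : Fin 3 → ℕ) k : ℤ) := by
    funext k; fin_cases k <;> simp
  rw [box3, e1, e2, card_box_natCast _ _ (by intro k; fin_cases k <;> simpa)]
  simp [Fin.prod_univ_three, mul_assoc]

/-- The offset vector with listed entries. -/
def off (i j k : ℤ) : Fin 3 → ℤ := ![i, j, k]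

/-- First entry of `off`. -/
@[simp] theorem off_zero (i j k : ℤ) : off i j k 0 = i := rfl
/-- Second entry of `off`. -/
@[simp] theorem off_one (i j k : ℤ) : off i j k 1 = j := rfl
/-- Third entry of `off`. -/
@[simp] theorem off_two (i j k : ℤ) : off i j k 2 = k := rfl

/-- The twelve fcc offsets as a list (same vectors as `fccOffsets`). -/
def offList : List (Fin 3 → ℤ) :=
  [off 1 0 0, off (-1) 0 0, off 0 1 0, off 0 (-1) 0, off 0 0 1, off 0 0 (-1),
    off 1 (-1) 0, off (-1) 1 0, off 1 0 (-1), off (-1) 0 1, off 0 1 (-1), off 0 (-1) 1]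

/-- The twelve listed offsets are distinct. -/
theorem offList_nodup : offList.Nodup := by decide

/-- `fccOffsets` is the finset of the listed offsets. -/
theorem fccOffsets_eq_offList : fccOffsets = offList.toFinset := by decide

/-- A sum over the twelve offsets, written out. -/
theorem sum_fccOffsets_eq (f : (Fin 3 → ℤ) → ℕ) :
    ∑ δ ∈ fccOffsets, f δ =
      f (off 1 0 0) + f (off (-1) 0 0) + f (off 0 1 0) + f (off 0 (-1) 0) + f (off 0 0 1) +
        f (off 0 0 (-1)) + f (off 1 (-1) 0) + f (off (-1) 1 0) + f (off 1 0 (-1)) +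
        f (off (-1) 0 1) + f (off 0 1 (-1)) + f (off 0 (-1) 1) := by
  rw [fccOffsets_eq_offList, List.sum_toFinset _ offList_nodup]
  simp [offList, add_assoc]

/-! ## The staircase piece -/

/-- **The fcc staircase** `S(m, L, s)`: the box `[0,L) × [0,m) × [0,m)` of coefficient vectors and the
`s` rows `{L} × [0,s) × [0,m)` of the next layer. -/
def stair (m L s : ℕ) : Finset (Fin 3 → ℤ) :=
  box3 0 L 0 m 0 m ∪ box3 L (L + 1) 0 s 0 m

variable {m L s : ℕ}

/-- Membership in the staircase. -/
theorem mem_stair {a : Fin 3 → ℤ} :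
    a ∈ stair m L s ↔
      (0 ≤ a 0 ∧ a 0 < L ∧ 0 ≤ a 1 ∧ a 1 < m ∧ 0 ≤ a 2 ∧ a 2 < m) ∨
        ((L : ℤ) ≤ a 0 ∧ a 0 < L + 1 ∧ 0 ≤ a 1 ∧ a 1 < s ∧ 0 ≤ a 2 ∧ a 2 < m) := by
  rw [stair, mem_union, mem_box3, mem_box3]

/-- The two parts of the staircase are disjoint. -/
theorem disjoint_stair_parts : Disjoint (box3 0 L 0 m 0 m) (box3 (L : ℤ) (L + 1) 0 s 0 m) := by
  rw [Finset.disjoint_left]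
  intro a h1 h2
  rw [mem_box3] at h1 h2
  omega

/-- **Ball count**: `#S(m, L, s) = L·m² + s·m`. -/
theorem card_stair (m L s : ℕ) : (stair m L s).card = L * m * m + s * m := by
  rw [stair, card_union_of_disjoint disjoint_stair_parts]
  have h1 := card_box3 0 L 0 m 0 m (Nat.zero_le _) (Nat.zero_le _) (Nat.zero_le _)
  have h2 := card_box3 L (L + 1) 0 s 0 m (Nat.le_succ _) (Nat.zero_le _) (Nat.zero_le _)
  push_cast at h1 h2
  rw [h1, h2]
  simp

/-! ## Six directions (and their opposites), two boxes each -/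

section Inclusions

variable (m L s : ℕ)

/-- The number of points of the staircase whose `δ`-neighbour is also in the staircase. -/
def dirCount (δ : Fin 3 → ℤ) : ℕ := ((stair m L s).filter fun a => a + δ ∈ stair m L s).card

variable {m L s} (hm : 1 ≤ m) (hL : 1 ≤ L) (hs : s < m)
include hm hL hs

/-- Direction `(1 0 0)` and its opposite. -/
theorem dir_p00 : 2 * ((L-1)*m*m + s*m) ≤ dirCount m L s (off 1 0 0) + dirCount m L s (-off 1 0 0) := by
  have h := card_add_card_le_of_two_sets (S := stair m L s) (δ := off 1 0 0)
    (T₁ := box3 (0:ℕ) (L-1:ℕ) (0:ℕ) m (0:ℕ) m) (T₂ := box3 (L-1:ℕ) L (0:ℕ) s (0:ℕ) m)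
    (by intro a ha; rw [mem_box3] at ha
        simp only [mem_stair, Pi.add_apply, off_zero, off_one, off_two]; omega)
    (by intro a ha; rw [mem_box3] at ha
        simp only [mem_stair, Pi.add_apply, off_zero, off_one, off_two]; omega)
    (by rw [Finset.disjoint_left]; intro a h1 h2; rw [mem_box3] at h1 h2; omega)
  rw [card_box3 _ _ _ _ _ _ (by omega) (by omega) (by omega),
    card_box3 _ _ _ _ _ _ (by omega) (by omega) (by omega)] at h
  simpa [dirCount, Nat.mul_assoc, show L - (L - 1) = 1 by omega] using h

omit hs in
/-- Direction `(0 1 0)` and its opposite. -/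
theorem dir_zp0 : 2 * (L*(m-1)*m + (s-1)*m) ≤ dirCount m L s (off 0 1 0) + dirCount m L s (-off 0 1 0) := by
  have h := card_add_card_le_of_two_sets (S := stair m L s) (δ := off 0 1 0)
    (T₁ := box3 (0:ℕ) L (0:ℕ) (m-1:ℕ) (0:ℕ) m) (T₂ := box3 L (L+1:ℕ) (0:ℕ) (s-1:ℕ) (0:ℕ) m)
    (by intro a ha; rw [mem_box3] at ha
        simp only [mem_stair, Pi.add_apply, off_zero, off_one, off_two]; omega)
    (by intro a ha; rw [mem_box3] at ha
        simp only [mem_stair, Pi.add_apply, off_zero, off_one, off_two]; omega)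
    (by rw [Finset.disjoint_left]; intro a h1 h2; rw [mem_box3] at h1 h2; omega)
  rw [card_box3 _ _ _ _ _ _ (by omega) (by omega) (by omega),
    card_box3 _ _ _ _ _ _ (by omega) (by omega) (by omega)] at h
  simpa [dirCount, Nat.mul_assoc] using h

/-- Direction `(0 0 1)` and its opposite. -/
theorem dir_zzp : 2 * (L*m*(m-1) + s*(m-1)) ≤ dirCount m L s (off 0 0 1) + dirCount m L s (-off 0 0 1) := by
  have h := card_add_card_le_of_two_sets (S := stair m L s) (δ := off 0 0 1)
    (T₁ := box3 (0:ℕ) L (0:ℕ) m (0:ℕ) (m-1:ℕ)) (T₂ := box3 L (L+1:ℕ) (0:ℕ) s (0:ℕ) (m-1:ℕ))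
    (by intro a ha; rw [mem_box3] at ha
        simp only [mem_stair, Pi.add_apply, off_zero, off_one, off_two]; omega)
    (by intro a ha; rw [mem_box3] at ha
        simp only [mem_stair, Pi.add_apply, off_zero, off_one, off_two]; omega)
    (by rw [Finset.disjoint_left]; intro a h1 h2; rw [mem_box3] at h1 h2; omega)
  rw [card_box3 _ _ _ _ _ _ (by omega) (by omega) (by omega),
    card_box3 _ _ _ _ _ _ (by omega) (by omega) (by omega)] at h
  simpa [dirCount, Nat.mul_assoc] using h

/-- Direction `(1 (-1) 0)` and its opposite. -/
theorem dir_pm0 : 2 * ((L-1)*(m-1)*m + s*m) ≤ dirCount m L s (off 1 (-1) 0) + dirCount m L s (-off 1 (-1) 0) := by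
  have h := card_add_card_le_of_two_sets (S := stair m L s) (δ := off 1 (-1) 0)
    (T₁ := box3 (0:ℕ) (L-1:ℕ) (1:ℕ) m (0:ℕ) m) (T₂ := box3 (L-1:ℕ) L (1:ℕ) (s+1:ℕ) (0:ℕ) m)
    (by intro a ha; rw [mem_box3] at ha
        simp only [mem_stair, Pi.add_apply, off_zero, off_one, off_two]; omega)
    (by intro a ha; rw [mem_box3] at ha
        simp only [mem_stair, Pi.add_apply, off_zero, off_one, off_two]; omega)
    (by rw [Finset.disjoint_left]; intro a h1 h2; rw [mem_box3] at h1 h2; omega)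
  rw [card_box3 _ _ _ _ _ _ (by omega) (by omega) (by omega),
    card_box3 _ _ _ _ _ _ (by omega) (by omega) (by omega)] at h
  simpa [dirCount, Nat.mul_assoc, show L - (L - 1) = 1 by omega] using h

/-- Direction `(1 0 (-1))` and its opposite. -/
theorem dir_p0m : 2 * ((L-1)*m*(m-1) + s*(m-1)) ≤ dirCount m L s (off 1 0 (-1)) + dirCount m L s (-off 1 0 (-1)) := by
  have h := card_add_card_le_of_two_sets (S := stair m L s) (δ := off 1 0 (-1))
    (T₁ := box3 (0:ℕ) (L-1:ℕ) (0:ℕ) m (1:ℕ) m) (T₂ := box3 (L-1:ℕ) L (0:ℕ) s (1:ℕ) m)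
    (by intro a ha; rw [mem_box3] at ha
        simp only [mem_stair, Pi.add_apply, off_zero, off_one, off_two]; omega)
    (by intro a ha; rw [mem_box3] at ha
        simp only [mem_stair, Pi.add_apply, off_zero, off_one, off_two]; omega)
    (by rw [Finset.disjoint_left]; intro a h1 h2; rw [mem_box3] at h1 h2; omega)
  rw [card_box3 _ _ _ _ _ _ (by omega) (by omega) (by omega),
    card_box3 _ _ _ _ _ _ (by omega) (by omega) (by omega)] at h
  simpa [dirCount, Nat.mul_assoc, show L - (L - 1) = 1 by omega] using h

omit hs in
/-- Direction `(0 1 (-1))` and its opposite. -/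
theorem dir_zpm : 2 * (L*(m-1)*(m-1) + (s-1)*(m-1)) ≤ dirCount m L s (off 0 1 (-1)) + dirCount m L s (-off 0 1 (-1)) := by
  have h := card_add_card_le_of_two_sets (S := stair m L s) (δ := off 0 1 (-1))
    (T₁ := box3 (0:ℕ) L (0:ℕ) (m-1:ℕ) (1:ℕ) m) (T₂ := box3 L (L+1:ℕ) (0:ℕ) (s-1:ℕ) (1:ℕ) m)
    (by intro a ha; rw [mem_box3] at ha
        simp only [mem_stair, Pi.add_apply, off_zero, off_one, off_two]; omega)
    (by intro a ha; rw [mem_box3] at ha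
        simp only [mem_stair, Pi.add_apply, off_zero, off_one, off_two]; omega)
    (by rw [Finset.disjoint_left]; intro a h1 h2; rw [mem_box3] at h1 h2; omega)
  rw [card_box3 _ _ _ _ _ _ (by omega) (by omega) (by omega),
    card_box3 _ _ _ _ _ _ (by omega) (by omega) (by omega)] at h
  simpa [dirCount, Nat.mul_assoc] using h

end Inclusions

/-! ## The contact number of the staircase -/

/-- The lattice-contact count of the staircase (exact, in closed form; truncated subtraction). -/
def stairContacts (m L s : ℕ) : ℕ :=
  (L - 1) * m * m + s * m + (L * (m - 1) * m + (s - 1) * m) + (L * m * (m - 1) + s * (m - 1)) +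
    ((L - 1) * (m - 1) * m + s * m) + ((L - 1) * m * (m - 1) + s * (m - 1)) +
    (L * (m - 1) * (m - 1) + (s - 1) * (m - 1))

/-- Negation of an offset, entrywise. -/
theorem neg_off (i j k : ℤ) : -off i j k = off (-i) (-j) (-k) := by
  funext t; fin_cases t <;> rfl

/-- **The staircase has at least `stairContacts m L s` contacts.** -/
theorem stairContacts_le_numContacts {m L s : ℕ} (hm : 1 ≤ m) (hL : 1 ≤ L) (hs : s < m) :
    stairContacts m L s ≤ numContacts (latConfig (stair m L s)) := by
  have hsum := sum_card_filter_le_two_mul_numContacts (S := stair m L s)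
  rw [sum_fccOffsets_eq] at hsum
  have h1 := dir_p00 hm hL hs
  have h2 := dir_zp0 (s := s) hm hL
  have h3 := dir_zzp hm hL hs
  have h4 := dir_pm0 hm hL hs
  have h5 := dir_p0m hm hL hs
  have h6 := dir_zpm (s := s) hm hL
  simp only [dirCount, neg_off, neg_zero, neg_neg] at h1 h2 h3 h4 h5 h6
  simp only [stairContacts]
  omega

/-- **`C(L·m² + s·m) ≥ stairContacts m L s`.** -/
theorem stairContacts_le_maxContacts {m L s : ℕ} (hm : 1 ≤ m) (hL : 1 ≤ L) (hs : s < m) :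
    stairContacts m L s ≤ maxContacts 3 (L * m * m + s * m) := by
  rw [← card_stair m L s]
  exact (stairContacts_le_numContacts hm hL hs).trans numContacts_latConfig_le_maxContacts

/-- **The deficit identity**: `6(L·m² + s·m) + L + 2m + [s ≠ 0] = stairContacts + 6Lm + 3m² + [s ≠ 0](3s + 2m)`,
i.e. the staircase misses exactly `L(6m − 1) + 3m² − 2m + [s ≠ 0](3s + 2m − 1)` contacts from `6` per ball. -/
theorem stairContacts_identity {m L s : ℕ} (hm : 1 ≤ m) (hL : 1 ≤ L) :
    6 * (L * m * m + s * m) + L + 2 * m + (if s = 0 then 0 else 1) =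
      stairContacts m L s + 6 * L * m + 3 * m * m + (if s = 0 then 0 else 3 * s + 2 * m) := by
  obtain ⟨m', rfl⟩ : ∃ m', m = m' + 1 := ⟨m - 1, by omega⟩
  obtain ⟨L', rfl⟩ : ∃ L', L = L' + 1 := ⟨L - 1, by omega⟩
  rcases Nat.eq_zero_or_pos s with rfl | hs0
  · simp [stairContacts]; ring
  · obtain ⟨s', rfl⟩ : ∃ s', s = s' + 1 := ⟨s - 1, by omega⟩
    simp [stairContacts]; ring

end Summit.Ventures.Crystal3D

end
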